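import Summits.SmoothPoincare4.SmoothPoincare4.Theses.ConvexBisection
import Literature.Geometry.Symplectic.SteinHandlebodies
import Literature.Geometry.Symplectic.SteinBoundaryContactProofs
import Literature.Topology.FourManifolds.MorseOrderedSublevelConnected
import Literature.Topology.FourManifolds.SPC4HandlesNormalFormProofs
import Literature.Topology.FourManifolds.MorseEulerEqualities
import Literature.Topology.FourManifolds.HomotopyS4CompactProofs
import Literature.Topology.FourManifolds.MorseProofs
import Literature.AlgebraicTopology.SingularHomology.CellsAttachmentEuler
import HarnessLib

/-!
# Stub `stub_steinHandleNormalForm` of line `exchange-recognition` for crux `ConvexBisection.AcyclicBisectionRigidity`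
(item stmt-SmoothPoincare4-10507, route route-SmoothPoincare4-ConvexBisection)

**A half of an acyclic Stein bisection of a homotopy `4`-sphere is a balanced `2`-handlebody**,
CONDITIONALLY on the named fact of the tree
`Literature.Geometry.Symplectic.Gompf1998_thm13_indexLE_two` (Gompf 1998, Thm. 1.3 (a) /
Eliashberg 1990: a compact Stein domain carries a Morse function adapted to the boundary all of
whose critical points have index `≤ 2`), fed in as the leading hypothesis exactly as the
fact-stubs of crux 4 (`stub_ballHalf`).

Setting: `M ≃ₕ S⁴` a (Hausdorff, second countable) `C^∞` `4`-manifold covered by two smoothly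
embedded compact Stein domains `e₁(W₁) ∪ e₂(W₂)` meeting exactly along the images of their
boundaries, both halves ℚ-acyclic in positive degrees.  Conclusion: `W₁` carries a Morse function
`f` adapted to `∂W₁` with all indices `≤ 2`, exactly one critical point of index `0` and as many
of index `1` as of index `2`.

Proof.
1. (Gompf) both halves carry adapted Morse functions `f₀ : W₁ → ℝ`, `f₂ : W₂ → ℝ` with indices
   `≤ 2`; the halves are Hausdorff and second countable, being embedded in `M`.
2. `W₁` is nonempty: otherwise `e₂` is onto, `W₂ ≠ ∅`, and the seam equation
   `range e₁ ∩ range e₂ = e₂(∂W₂)` forces `∂W₂ = ∅`, while the `J`-convex function of `J₂`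
   attains its maximum on `∂W₂` (`SteinStructure.exists_isBoundaryPoint`).
3. `W₁` is CONNECTED (the `H₀` bookkeeping, done point-set topologically): `M` is connected
   (`S⁴` is path connected and path components are homotopy invariant); every connected
   component `C` of `W₂` meets `∂W₂` in a preconnected set, because `f₂` has no critical point
   of coindex `≤ 1` (the tree's `IsMorseAdapted.isPreconnected_connectedComponent_inter_boundary`,
   Milnor 1963 Thms. 3.1–3.2: dually `W₂` is `∂W₂ × I` with handles of index `≥ 2` attached);
   hence a splitting `e₁(W₁) = A ⊔ B` into closed pieces would either split `M` into
   `A ∪ e₂(components adhering to A)` and `B ∪ e₂(the other components)`, or produce a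
   component of `W₂` whose trace on the seam meets both `A` and `B` — impossible either way
   (`isPreconnected_of_cover`).
4. Cancel the surplus minima of `f₀` against `1`-handles (Milnor 1965, Thm. 8.1 Index 0; the
   tree's PROVED cancellation step
   `exists_isMorseAdapted_ncard_criticalSetOfIndex_zero_add_one_eq_holds`, which keeps the
   counts of every index `≥ 2`): an adapted Morse `f` with one critical point of index `0` and
   still none of index `≥ 3`.
5. `χ(W₁) = Σₖ (-1)ᵏ #critₖ(f) = 1 - c₁ + c₂` (Matsumoto 2002, Cor. 4.19; the tree's
   `IsMorseAdapted.finRelHomology_empty`) and `χ(W₁) = Σₖ (-1)ᵏ b_k(W₁; ℚ) = b₀ = 1`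
   (ℚ-acyclicity in positive degrees; `H₀ ≅ ℚ` for the path connected `W₁`), so `c₁ = c₂`.

## References

* R. E. Gompf, *Handlebody construction of Stein surfaces*, Ann. of Math. 148 (1998), Thm. 1.3.
  [Gompf1998]
* J. Milnor, *Lectures on the h-cobordism theorem* (1965), Thm. 8.1. [MilnorHCobordism1965]
* J. Milnor, *Morse theory* (1963), §3, Thms. 3.1–3.2. [Milnor1963]
* Y. Matsumoto, *An introduction to Morse theory* (2002), Thm. 3.35, Cor. 4.19. [Matsumoto2001]
-/

noncomputable section

-- the prescribed namespace `Summit.<P>.<Sub>.…` duplicates `SmoothPoincare4` (P = Sub)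
set_option linter.dupNamespace false

open scoped Manifold ContDiff Topology ContinuousMap
open Set Function
open Literature.Geometry.Symplectic Literature.AlgebraicTopology.SingularHomology
  Literature.Topology.FourManifolds CategoryTheory.Limits

namespace Summit.SmoothPoincare4.SmoothPoincare4.Theorems.AcyclicBisectionRigidity.ExchangeRecognition

/-! ### Topology: a closed piece of a connected space glued to a compact piece along traces of components -/

/-- **Connectedness across a seam.**  Let `X` be a preconnected Hausdorff space covered by a
closed set `S` and the image of a compact locally connected space `W` under a continuous
injection `e`, with `S ∩ e(W) = e(B)` for some `B ⊆ W` (the "seam"), and suppose every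
connected component of `W` meets `B` in a preconnected set.  Then `S` is preconnected: if
`S = (S ∩ u) ⊔ (S ∩ v)` split along closed sets `u`, `v`, then either no component of `W`
adheres (through `e`) to both pieces — and `X` splits into `(S ∩ u) ∪ e(components adhering to
u)` and `(S ∩ v) ∪ e(the others)`, two disjoint closed sets — or some component does, and its
trace on `B`, a preconnected subset of `S` meeting both `u` and `v`, is split.  (The argument of
the tree's `RegularSublevel.connectedSpace_of_two_le_morseIndex`, with the level replaced by an
abstract seam.) [folklore] -/
theorem isPreconnected_of_cover {X W : Type*} [TopologicalSpace X] [T2Space X]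
    [PreconnectedSpace X] [TopologicalSpace W] [CompactSpace W] [LocallyConnectedSpace W]
    {S : Set X} (hS : IsClosed S) {e : W → X} (he : Continuous e) (hinj : Injective e)
    (hcover : S ∪ range e = univ) {B : Set W} (hseam : S ∩ range e = e '' B)
    (hcomp : ∀ x₀ : W, IsPreconnected (connectedComponent x₀ ∩ B)) :
    IsPreconnected S := by
  rw [isPreconnected_iff_subset_of_disjoint_closed]
  intro u v hu hv huv hdisj
  by_contra hcon
  rcases not_or.1 hcon with ⟨hSu, hSv⟩
  obtain ⟨a₀, ha₀S, ha₀v⟩ := not_subset.1 hSv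
  obtain ⟨b₀, hb₀S, hb₀u⟩ := not_subset.1 hSu
  have ha₀ : a₀ ∈ u := (huv ha₀S).resolve_right ha₀v
  have hb₀ : b₀ ∈ v := (huv hb₀S).resolve_left hb₀u
  have hAB : ∀ y, y ∈ S → y ∈ u → y ∈ v → False := fun y hyS hyu hyv => by
    have : y ∈ S ∩ (u ∩ v) := ⟨hyS, hyu, hyv⟩
    rw [hdisj] at this
    exact this
  -- points of `W` mapped into `S` lie on the seam `B`
  have hB : ∀ x : W, e x ∈ S → x ∈ B := fun x hx => by
    have h : e x ∈ e '' B := by rw [← hseam]; exact ⟨hx, x, rfl⟩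
    obtain ⟨x', hx', hxx'⟩ := h
    exact hinj hxx' ▸ hx'
  -- the predicate "the component of `x` adheres to `S ∩ u`"
  set P : W → Prop := fun x => (e '' connectedComponent x ∩ (S ∩ u)).Nonempty with hP
  have hPconst : ∀ x y : W, y ∈ connectedComponent x → (P x ↔ P y) := fun x y hy => by
    simp only [hP, connectedComponent_eq hy]
  have hPclopen : IsClopen {x | P x} := isClopen_setOf_of_connectedComponent hPconst
  by_cases hboth : ∃ x : W, P x ∧ (e '' connectedComponent x ∩ (S ∩ v)).Nonempty
  swap
  · -- no component adheres to both pieces: `X` splits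
    set A' : Set X := (S ∩ u) ∪ e '' {x | P x} with hA'
    set B' : Set X := (S ∩ v) ∪ e '' {x | ¬ P x} with hB'
    have hA'c : IsClosed A' :=
      (hS.inter hu).union ((hPclopen.1.isCompact.image he).isClosed)
    have hB'c : IsClosed B' :=
      (hS.inter hv).union ((hPclopen.compl.1.isCompact.image he).isClosed)
    have hcover' : univ ⊆ A' ∪ B' := by
      intro y _
      by_cases hy : y ∈ S
      · rcases huv hy with hyu | hyv
        · exact Or.inl (Or.inl ⟨hy, hyu⟩)
        · exact Or.inr (Or.inl ⟨hy, hyv⟩)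
      · have hy' : y ∈ S ∪ range e := by rw [hcover]; exact mem_univ y
        obtain ⟨x, rfl⟩ := hy'.resolve_left hy
        by_cases hx : P x
        · exact Or.inl (Or.inr ⟨x, hx, rfl⟩)
        · exact Or.inr (Or.inr ⟨x, hx, rfl⟩)
    have hdisj' : univ ∩ (A' ∩ B') = ∅ := by
      rw [univ_inter]
      refine Set.eq_empty_of_forall_notMem fun y hy => ?_
      obtain ⟨hyA, hyB⟩ := hy
      rcases hyA with ⟨hyS, hyu⟩ | ⟨x, hx, rfl⟩
      · rcases hyB with ⟨-, hyv⟩ | ⟨x, hx, hxy⟩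
        · exact hAB y hyS hyu hyv
        · exact hx ⟨y, ⟨⟨x, mem_connectedComponent, hxy⟩, hyS, hyu⟩⟩
      · rcases hyB with ⟨hyS, hyv⟩ | ⟨x', hx', hx'y⟩
        · exact hboth ⟨x, hx, e x, ⟨x, mem_connectedComponent, rfl⟩, hyS, hyv⟩
        · rw [hinj hx'y] at hx'
          exact hx' hx
    rcases (isPreconnected_iff_subset_of_disjoint_closed.1 isPreconnected_univ) A' B' hA'c hB'c
      hcover' hdisj' with hA | hB
    · have hb₀A : b₀ ∈ A' := hA (mem_univ b₀)
      rcases hb₀A with ⟨-, hb₀u'⟩ | ⟨x, hPx, hxb⟩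
      · exact hAB b₀ hb₀S hb₀u' hb₀
      · exact hboth ⟨x, hPx, b₀, ⟨x, mem_connectedComponent, hxb⟩, hb₀S, hb₀⟩
    · have ha₀B : a₀ ∈ B' := hB (mem_univ a₀)
      rcases ha₀B with ⟨-, ha₀v'⟩ | ⟨x, hx, hxa⟩
      · exact hAB a₀ ha₀S ha₀ ha₀v'
      · exact hx ⟨a₀, ⟨x, mem_connectedComponent, hxa⟩, ha₀S, ha₀⟩
  -- a component adhering to both pieces has a split trace on the seam: contradiction
  obtain ⟨x₀, ⟨ya, ⟨xa, hxaC, rfl⟩, hyaS, hyau⟩, ⟨yb, ⟨xb, hxbC, rfl⟩, hybS, hybv⟩⟩ := hboth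
  set T : Set X := e '' (connectedComponent x₀ ∩ B) with hT
  have hTpc : IsPreconnected T := (hcomp x₀).image e he.continuousOn
  have hTS : T ⊆ S := by
    rintro _ ⟨x, ⟨-, hx⟩, rfl⟩
    have h : e x ∈ S ∩ range e := by rw [hseam]; exact ⟨x, hx, rfl⟩
    exact h.1
  have hxa : e xa ∈ T := ⟨xa, ⟨hxaC, hB xa hyaS⟩, rfl⟩
  have hxb : e xb ∈ T := ⟨xb, ⟨hxbC, hB xb hybS⟩, rfl⟩
  rcases (isPreconnected_iff_subset_of_disjoint_closed.1 hTpc) u v hu hv (hTS.trans huv)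
    (Set.eq_empty_of_forall_notMem fun y hy => hAB y (hTS hy.1) hy.2.1 hy.2.2) with hTu | hTv
  · exact hAB _ hybS (hTu hxb) hybv
  · exact hAB _ hyaS hyau (hTv hxa)

/-! ### Morse theory on a half: cancelling surplus minima, keeping the higher handles -/

/-- **Cancelling surplus `0`-handles against `1`-handles, keeping every handle of index `≥ 2`**
(Milnor 1965, Thm. 8.1 Index 0, "a finite induction"; Matsumoto 2002, proof of Thm. 3.35): on a
compact connected `(n+1)`-manifold with boundary, an adapted Morse function with `r + 1` critical
points of index `0` can be replaced by one with a single critical point of index `0` and as many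
critical points of each index `k ≥ 2` — by the tree's proved cancellation step
`exists_isMorseAdapted_ncard_criticalSetOfIndex_zero_add_one_eq_holds`, iterated.
[cite: MilnorHCobordism1965, Thm. 8.1 Index 0 and its proof] -/
theorem exists_isMorseAdapted_ncard_zero_eq_one_keep {n : ℕ} {W : Type} [TopologicalSpace W]
    [T2Space W] [SecondCountableTopology W] [CompactSpace W] [ConnectedSpace W]
    [ChartedSpace (EuclideanHalfSpace (n + 1)) W] [IsManifold (𝓡∂ (n + 1)) ∞ W] :
    ∀ (r : ℕ) (f : W → ℝ), IsMorseAdapted (𝓡∂ (n + 1)) f →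
      (criticalSetOfIndex (𝓡∂ (n + 1)) f 0).ncard = r + 1 →
      ∃ g : W → ℝ, IsMorseAdapted (𝓡∂ (n + 1)) g ∧
        (criticalSetOfIndex (𝓡∂ (n + 1)) g 0).ncard = 1 ∧
        ∀ k, 2 ≤ k → (criticalSetOfIndex (𝓡∂ (n + 1)) g k).ncard =
          (criticalSetOfIndex (𝓡∂ (n + 1)) f k).ncard := by
  intro r
  induction r with
  | zero =>
    intro f hf h0
    exact ⟨f, hf, h0, fun k _ => rfl⟩
  | succ r ih =>
    intro f hf h0
    obtain ⟨g₁, hg₁, h0₁, -, hk₁⟩ :=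
      exists_isMorseAdapted_ncard_criticalSetOfIndex_zero_add_one_eq_holds n W f hf (by omega)
    obtain ⟨g, hg, h0g, hkg⟩ := ih g₁ hg₁ (by omega)
    exact ⟨g, hg, h0g, fun k hk => (hkg k hk).trans (hk₁ k hk)⟩

/-- **Normal form of a connected `2`-handlebody** (Milnor 1965, Thm. 8.1 Index 0 applied to a
`4`-dimensional `2`-handlebody): a compact connected nonempty `4`-manifold with boundary carrying
an adapted Morse function with all critical points of index `≤ 2` carries one with all critical
points of index `≤ 2` and EXACTLY ONE critical point of index `0` (the surplus minima — there is
at least one, `IsMorseAdapted.one_le_ncard_criticalSetOfIndex_zero` — cancel against `1`-handles;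
no critical point of index `≥ 3` is created, the counts of index `≥ 2` being kept).
[cite: MilnorHCobordism1965, Thm. 8.1 Index 0 and its proof] -/
theorem exists_isMorseAdapted_indexLE_two_ncard_zero_eq_one {W : Type} [TopologicalSpace W]
    [T2Space W] [SecondCountableTopology W] [CompactSpace W] [ConnectedSpace W]
    [ChartedSpace (EuclideanHalfSpace 4) W] [IsManifold (𝓡∂ 4) ∞ W]
    (h : IsHandlebodyOfIndexLE 3 2 W) :
    ∃ f : W → ℝ, IsMorseAdapted (𝓡∂ 4) f ∧
      (∀ z, IsMCriticalPt (𝓡∂ 4) f z → morseIndex (𝓡∂ 4) f z ≤ 2) ∧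
      (criticalSetOfIndex (𝓡∂ 4) f 0).ncard = 1 := by
  obtain ⟨f₀, hf₀, hf₀i⟩ := h
  have hf₀' : IsMorseAdapted (𝓡∂ 4) f₀ := hf₀
  have hf₀i' : ∀ z, IsMCriticalPt (𝓡∂ 4) f₀ z → morseIndex (𝓡∂ 4) f₀ z ≤ 2 := hf₀i
  have hfin₀ : ∀ k, (criticalSetOfIndex (𝓡∂ 4) f₀ k).Finite := fun k =>
    (IsMorse.finite_criticalSet_holds hf₀'.isMorse).subset (criticalSetOfIndex_subset _ f₀ k)
  -- no critical points of index `≥ 3`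
  have h3₀ : ∀ k, 3 ≤ k → (criticalSetOfIndex (𝓡∂ 4) f₀ k).ncard = 0 := by
    intro k hk
    rw [Set.ncard_eq_zero (hfin₀ k)]
    refine Set.eq_empty_of_forall_notMem fun x hx => ?_
    have hle := hf₀i' x hx.1
    rw [hx.2] at hle
    omega
  -- at least one critical point of index `0`; cancel the others
  have h1 : 1 ≤ (criticalSetOfIndex (𝓡∂ 4) f₀ 0).ncard :=
    hf₀'.one_le_ncard_criticalSetOfIndex_zero
  obtain ⟨r, hr⟩ : ∃ r, (criticalSetOfIndex (𝓡∂ 4) f₀ 0).ncard = r + 1 :=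
    ⟨(criticalSetOfIndex (𝓡∂ 4) f₀ 0).ncard - 1, by omega⟩
  obtain ⟨f, hf, hf0, hfk⟩ :=
    exists_isMorseAdapted_ncard_zero_eq_one_keep (n := 3) r f₀ hf₀ hr
  have hf' : IsMorseAdapted (𝓡∂ 4) f := hf
  have hf0' : (criticalSetOfIndex (𝓡∂ 4) f 0).ncard = 1 := hf0
  have hfk' : ∀ k, 2 ≤ k →
      (criticalSetOfIndex (𝓡∂ 4) f k).ncard = (criticalSetOfIndex (𝓡∂ 4) f₀ k).ncard := hfk
  have hfin : ∀ k, (criticalSetOfIndex (𝓡∂ 4) f k).Finite := fun k =>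
    (IsMorse.finite_criticalSet_holds hf'.isMorse).subset (criticalSetOfIndex_subset _ f k)
  refine ⟨f, hf', fun z hz => ?_, hf0'⟩
  by_contra hlt
  have hmem : z ∈ criticalSetOfIndex (𝓡∂ 4) f (morseIndex (𝓡∂ 4) f z) := ⟨hz, rfl⟩
  have h0 : (criticalSetOfIndex (𝓡∂ 4) f (morseIndex (𝓡∂ 4) f z)).ncard = 0 := by
    rw [hfk' _ (by omega)]
    exact h3₀ _ (by omega)
  rw [(Set.ncard_eq_zero (hfin _)).1 h0] at hmem
  exact hmem

/-- **The Euler characteristic count of a balanced handlebody** (Matsumoto 2002, Cor. 4.19: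
`χ(W) = Σₖ (-1)ᵏ cₖ` for a handlebody with `cₖ` handles of index `k`, the tree's
`IsMorseAdapted.finRelHomology_empty`; Hatcher 2002, Thm. 2.44): for an adapted Morse function
`f` on a compact connected `4`-manifold with boundary `W` which is ℚ-acyclic in positive degrees,
with all critical points of index `≤ 2` and exactly one of index `0`, the numbers of critical
points of index `1` and `2` agree: `1 = b₀(W) = χ(W) = 1 - c₁ + c₂`.
[cite: Matsumoto2001, Cor. 4.19] -/
theorem ncard_one_eq_ncard_two_of_acyclic {W : Type} [TopologicalSpace W]
    [T2Space W] [SecondCountableTopology W] [CompactSpace W] [ConnectedSpace W]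
    [ChartedSpace (EuclideanHalfSpace 4) W] [IsManifold (𝓡∂ 4) ∞ W]
    (hac : ∀ k, 0 < k → IsZero (singularHomology ℚ ℚ W k))
    {f : W → ℝ} (hf : IsMorseAdapted (𝓡∂ 4) f)
    (hfi : ∀ z, IsMCriticalPt (𝓡∂ 4) f z → morseIndex (𝓡∂ 4) f z ≤ 2)
    (hf0 : (criticalSetOfIndex (𝓡∂ 4) f 0).ncard = 1) :
    (criticalSetOfIndex (𝓡∂ 4) f 1).ncard = (criticalSetOfIndex (𝓡∂ 4) f 2).ncard := by
  haveI : LocallyPathConnectedSpace W :=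
    ChartedSpace.locallyPathConnectedSpace (EuclideanHalfSpace 4) W
  haveI : PathConnectedSpace W := pathConnectedSpace_iff_connectedSpace.2 inferInstance
  have hfin : ∀ k, (criticalSetOfIndex (𝓡∂ 4) f k).Finite := fun k =>
    (IsMorse.finite_criticalSet_holds hf.isMorse).subset (criticalSetOfIndex_subset _ f k)
  have h3 : ∀ k, 3 ≤ k → (criticalSetOfIndex (𝓡∂ 4) f k).ncard = 0 := by
    intro k hk
    rw [Set.ncard_eq_zero (hfin k)]
    refine Set.eq_empty_of_forall_notMem fun x hx => ?_
    have hle := hfi x hx.1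
    rw [hx.2] at hle
    omega
  -- the Morse equality `χ(W) = Σ (-1)^k c_k`
  obtain ⟨hFin, hχ⟩ := hf.finRelHomology_empty ℚ ℚ
  rw [hFin.relEuler_empty_eq_sum] at hχ
  -- Betti numbers: `b₀ = 1`, `b_k = 0` for `k > 0`
  have hH0 : Module.finrank ℚ (singularHomology ℚ ℚ W 0) = 1 := by
    rw [finrank_singularHomology_zero_of_pathConnectedSpace ℚ ℚ, Module.finrank_self]
  have hHk : ∀ k, 0 < k → Module.finrank ℚ (singularHomology ℚ ℚ W k) = 0 := fun k hk =>
    finrank_eq_zero_of_isZero (hac k hk)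
  have hc3 : (criticalSetOfIndex (𝓡∂ 4) f 3).ncard = 0 := h3 3 le_rfl
  have hc4 : (criticalSetOfIndex (𝓡∂ 4) f 4).ncard = 0 := h3 4 (by norm_num)
  simp only [Finset.sum_range_succ, Finset.sum_range_zero, hH0, hHk 1 one_pos, hHk 2 two_pos,
    hHk 3 (by norm_num), hHk 4 (by norm_num), Module.finrank_self] at hχ
  have hc3' : (criticalSetOfIndex (𝓡∂ (3 + 1)) f 3).ncard = 0 := hc3
  have hc4' : (criticalSetOfIndex (𝓡∂ (3 + 1)) f 4).ncard = 0 := hc4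
  have hc0' : (criticalSetOfIndex (𝓡∂ (3 + 1)) f 0).ncard = 1 := hf0
  rw [hc3', hc4', hc0'] at hχ
  have key : ((criticalSetOfIndex (𝓡∂ (3 + 1)) f 1).ncard : ℤ) =
      ((criticalSetOfIndex (𝓡∂ (3 + 1)) f 2).ncard : ℤ) := by
    push_cast at hχ
    linarith
  exact_mod_cast key

/-! ### The stub -/

/-- **Stub `stub_steinHandleNormalForm` (a half of an acyclic Stein bisection is a balanced
`2`-handlebody; conditional on Gompf 1998, Thm. 1.3 (a)).**  Under the crux hypotheses
(`M ≃ₕ S⁴`; compact Stein halves `(W₁,J₁)`, `(W₂,J₂)` smoothly embedded, covering `M` and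
meeting exactly along the images of their boundaries; matched complex tangencies; both halves
ℚ-acyclic in positive degrees) and the named fact `Gompf1998_thm13_indexLE_two` (compact Stein
domains are `2`-handlebodies), the first half `W₁` carries a Morse function adapted to `∂W₁`
with all critical points of index `≤ 2`, exactly one of index `0`, and as many of index `1` as
of index `2`.  Proof: Gompf's fact gives adapted Morse functions with indices `≤ 2` on both
halves; `W₁ ≠ ∅` (else `∂W₂ = ∅`, against `SteinStructure.exists_isBoundaryPoint`); `W₁` is
connected (`isPreconnected_of_cover`: `M` is connected and every component of `W₂` has
connected trace on `∂W₂`, `IsMorseAdapted.isPreconnected_connectedComponent_inter_boundary`);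
cancel the surplus minima (`exists_isMorseAdapted_indexLE_two_ncard_zero_eq_one`, Milnor 1965
Thm. 8.1); count `χ(W₁) = 1 = 1 - c₁ + c₂` (`ncard_one_eq_ncard_two_of_acyclic`).  The matched
tangencies `_hξ`, the seam equation `_hseam₁` for `W₁` and the acyclicity of `W₂` are part of the
registered signature but are not used.
[cite: Gompf1998, Thm. 1.3] [cite: MilnorHCobordism1965, Thm. 8.1] -/
theorem stub_steinHandleNormalForm (hG : Gompf1998_thm13_indexLE_two)
    (M : Type) [TopologicalSpace M] [T2Space M] [SecondCountableTopology M]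
    [ChartedSpace (EuclideanSpace ℝ (Fin 4)) M] [IsManifold (𝓡 4) ∞ M]
    (hM : M ≃ₕ Metric.sphere (0 : EuclideanSpace ℝ (Fin 5)) 1)
    (W₁ : Type) [TopologicalSpace W₁] [ChartedSpace (EuclideanHalfSpace 4) W₁] [IsManifold (𝓡∂ 4) ∞ W₁]
    [CompactSpace W₁] (W₂ : Type) [TopologicalSpace W₂] [ChartedSpace (EuclideanHalfSpace 4) W₂]
    [IsManifold (𝓡∂ 4) ∞ W₂] [CompactSpace W₂] (J₁ : SteinStructure W₁) (J₂ : SteinStructure W₂)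
    (e₁ : W₁ → M) (e₂ : W₂ → M)
    (he₁ : Manifold.IsSmoothEmbedding (𝓡∂ 4) (𝓡 4) ∞ e₁)
    (he₂ : Manifold.IsSmoothEmbedding (𝓡∂ 4) (𝓡 4) ∞ e₂)
    (hcover : range e₁ ∪ range e₂ = univ)
    (_hseam₁ : range e₁ ∩ range e₂ = e₁ '' (𝓡∂ 4).boundary W₁)
    (hseam₂ : range e₁ ∩ range e₂ = e₂ '' (𝓡∂ 4).boundary W₂)
    (_hξ : ∀ w₁ w₂, e₁ w₁ = e₂ w₂ →
      Submodule.map (mfderiv (𝓡∂ 4) (𝓡 4) e₁ w₁).toLinearMap (contactPlane J₁.J w₁) =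
      Submodule.map (mfderiv (𝓡∂ 4) (𝓡 4) e₂ w₂).toLinearMap (contactPlane J₂.J w₂))
    (hac : ∀ k, 0 < k → IsZero (singularHomology ℚ ℚ W₁ k) ∧ IsZero (singularHomology ℚ ℚ W₂ k)) :
    ∃ f : W₁ → ℝ, IsMorseAdapted (𝓡∂ 4) f ∧
      (∀ z, IsMCriticalPt (𝓡∂ 4) f z → morseIndex (𝓡∂ 4) f z ≤ 2) ∧
      (criticalSetOfIndex (𝓡∂ 4) f 0).ncard = 1 ∧
      (criticalSetOfIndex (𝓡∂ 4) f 1).ncard = (criticalSetOfIndex (𝓡∂ 4) f 2).ncard := by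
  -- the halves are Hausdorff and second countable, being embedded in `M`
  haveI : T2Space W₁ := he₁.isEmbedding.t2Space
  haveI : T2Space W₂ := he₂.isEmbedding.t2Space
  haveI : SecondCountableTopology W₁ := he₁.isEmbedding.secondCountableTopology
  haveI : SecondCountableTopology W₂ := he₂.isEmbedding.secondCountableTopology
  haveI : LocallyPathConnectedSpace W₂ :=
    ChartedSpace.locallyPathConnectedSpace (EuclideanHalfSpace 4) W₂
  -- `M` is path connected (hence connected and nonempty)
  haveI : PathConnectedSpace M := by
    haveI := pathConnectedSpace_sphere_four
    exact pathConnectedSpace_of_homotopyEquiv hM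
  -- (1) Gompf: the second half is a `2`-handlebody
  obtain ⟨f₂, hf₂, hf₂i⟩ := hG.of_steinStructure W₂ J₂
  have hf₂' : IsMorseAdapted (𝓡∂ 4) f₂ := hf₂
  have hf₂i' : ∀ z, IsMCriticalPt (𝓡∂ 4) f₂ z → morseIndex (𝓡∂ 4) f₂ z ≤ 2 := hf₂i
  -- (2) the first half is nonempty
  haveI : Nonempty W₁ := by
    by_contra h
    haveI : IsEmpty W₁ := not_nonempty_iff.mp h
    have h₁ : range e₁ = ∅ := range_eq_empty e₁
    have hcov : range e₂ = univ := by rw [← hcover, h₁, empty_union]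
    haveI : Nonempty W₂ := by
      obtain ⟨m⟩ := (inferInstance : Nonempty M)
      have hm : m ∈ range e₂ := by rw [hcov]; exact mem_univ m
      obtain ⟨w, -⟩ := hm
      exact ⟨w⟩
    obtain ⟨x, hx⟩ := J₂.exists_isBoundaryPoint
    have hx' : e₂ x ∈ range e₁ ∩ range e₂ := by rw [hseam₂]; exact ⟨x, hx, rfl⟩
    rw [h₁, empty_inter] at hx'
    exact hx'
  -- (3) the first half is connected
  haveI : ConnectedSpace W₁ := by
    have hcomp : ∀ x₀ : W₂, IsPreconnected (connectedComponent x₀ ∩ (𝓡∂ 4).boundary W₂) :=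
      fun x₀ => hf₂'.isPreconnected_connectedComponent_inter_boundary
        (fun x _ hx => by have := hf₂i' x hx; omega) x₀
    have hpre : IsPreconnected (range e₁) :=
      isPreconnected_of_cover (isCompact_range he₁.isEmbedding.continuous).isClosed
        he₂.isEmbedding.continuous he₂.isEmbedding.injective hcover hseam₂ hcomp
    have huniv : IsPreconnected (univ : Set W₁) := by
      rw [← he₁.isEmbedding.isInducing.isPreconnected_image, image_univ]
      exact hpre
    haveI : PreconnectedSpace W₁ := ⟨huniv⟩
    exact ⟨inferInstance⟩
  -- (1)+(4) Gompf on the first half; cancel the surplus minima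
  obtain ⟨f, hf, hfi, hf0⟩ :=
    exists_isMorseAdapted_indexLE_two_ncard_zero_eq_one (hG.of_steinStructure W₁ J₁)
  -- (5) the Euler characteristic count
  exact ⟨f, hf, hfi, hf0, ncard_one_eq_ncard_two_of_acyclic (fun k hk => (hac k hk).1) hf hfi hf0⟩

end Summit.SmoothPoincare4.SmoothPoincare4.Theorems.AcyclicBisectionRigidity.ExchangeRecognition

end
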